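import Mathlib
import HarnessLib
import Literature.NumberTheory.Automorphic.ArthurClozelWeakLiftingIsobaric
import Literature.NumberTheory.Automorphic.ArthurClozelBaseChangeAssembly
import Literature.NumberTheory.Automorphic.StrongMultiplicityOneLevel
import Literature.NumberTheory.Automorphic.StrongMultiplicityOneGLOne
import Literature.NumberTheory.Automorphic.PairLFunctionPolesEqConjLeTwo
import Literature.NumberTheory.Automorphic.PairLFunctionPolesNeConjRankOne
import Literature.NumberTheory.Automorphic.PairLFunctionPolesGLOneBoundaryUnconditional
import Summits.Langlands.Langlands.Theorems.ParityBlindBianchiQuadraticBaseChangeGL2CardLeOneMembers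

/-!
# Stub `stub_weakLiftingGL2_of_liftDatum_rank2` of line Sketch (crux stmt-Langlands-16812
`ParityBlindBianchi.QuadraticBaseChangeGL2`) — Arthur–Clozel Thm. 4.2 (a) in `L²` at rank 2 from the
isobaric weak-lift datum and the RANK-2 Jacquet–Shalika / multiplicity-one facts only

Helper file (`--supports stmt-Langlands-16812`).  Same reduction as the all-rank
`stub_weakLiftingGL2_of_liftDatum`, but the named inputs are only: multiplicity one on `L²_cusp(GL₂)`,
Jacquet–Shalika (2.2) `…_boundary_of_ne_one` at ranks `(2,2)` and `…_at_one_of_ne_conj` at rank `2` —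
because at `n = 2` the members of an isobaric datum have ranks `(1,1)` or `(2,2)` (`memberRank_dichotomy`),
the rank-`1` instances and (2.3) at ranks `≤ 2` are theorems of the tree
(`multiplicity_one_gl_one`, `JacquetShalika1981_partialPairL_boundary_of_ne_one_one`,
`JacquetShalika1981_partialPairL_at_one_of_ne_conj_one`, `JacquetShalika1981_partialPairL_pole_of_eq_conj_holds_of_le_two`),
and `…_at_one_of_rank_ne` is only ever needed at equal ranks, where it is vacuous.  The `L`-function step is
the member-indexed `stub_card_le_one_of_isobaricWeakLift_members`.

No definitions, no named facts.
-/

noncomputable section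

open scoped MatrixGroups Topology NumberField
open NumberField IsDedekindDomain MeasureTheory Filter Literature.NumberTheory.Automorphic
  Literature.NumberTheory.Automorphic.AdelicGroupData
open Literature.NumberTheory.GaloisRepresentations (HeckeCharacter finite_setOf_not_isUnramifiedIn
  ramificationIdxIn_eq_one_of_isUnramifiedIn)

-- `Summit.Langlands.Langlands.…`: summit = sub-problem name (D-0017 nested layout), not a typo.
set_option linter.dupNamespace false

namespace Summit.Langlands.Langlands.Theorems.QuadraticBaseChangeGL2

/-- **Member ranks of a rank-2 isobaric datum**: if `dₘ ≥ 1` for all members and `∑ dₘ = 2`, then any two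
members `m, m'` have ranks `(1,1)` or `(2,2)` (in the latter case `m = m'`). [folklore] -/
theorem memberRank_dichotomy {M : Type} [Fintype M] {d : M → ℕ} (hd : ∀ m, 0 < d m)
    (hdn : ∑ m, d m = 2) (m m' : M) : (d m = 1 ∧ d m' = 1) ∨ (d m = 2 ∧ d m' = 2) := by
  classical
  have hle : ∀ m, d m ≤ 2 := fun m =>
    hdn ▸ Finset.single_le_sum (fun i _ => (hd i).le) (Finset.mem_univ m)
  have hpair : m ≠ m' → d m + d m' ≤ 2 := fun hne => by
    have h := Finset.sum_le_sum_of_subset_of_nonneg (f := d) (Finset.subset_univ {m, m'})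
      (fun i _ _ => (hd i).le)
    rw [Finset.sum_pair hne] at h
    omega
  by_cases hmm : m = m'
  · subst hmm
    have h1 := hd m
    have h2 := hle m
    omega
  · have h1 := hd m
    have h2 := hd m'
    have h3 := hpair hmm
    omega

/-- **STUB (rank-2 inputs) `stub_weakLiftingGL2_of_liftDatum_rank2`** — Arthur–Clozel Ch. 3 Thm. 4.2 (a)
in `L²` at rank `2` for quadratic `E/F`, `ArthurClozel1989_weakLifting_cuspidal 2 F E`, from the isobaric
weak-lift datum `hI` at `n = 2` and the RANK-2 named facts only: multiplicity one on `L²_cusp(GL₂)` (`hm1`),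
Jacquet–Shalika (2.2) on the line for `GL₂ × GL₂` (`h22a`) and at `s = 1` for `π' ≇ π̃` on `GL₂` (`h22c`).
Proof: the `n = 2` copy of `exists_cuspidal_weakLift_of_isobaricLiftFamilies` through the member-indexed
`stub_card_le_one_of_isobaricWeakLift_members`, whose member-rank inputs are dispatched on `memberRank_dichotomy`
to the proved rank-`1` theorems / the rank-`2` hypotheses ((2.3): proved at ranks `≤ 2`; `rank_ne`:
vacuous at equal ranks); then `arthurClozel1989_weakLifting_cuspidal_of_exists` with strong multiplicity one
over `E` from `strong_multiplicity_one_gl_of_jacquetShalika_unconditional hm1 h22c (2.3)₂`.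
[cite: ArthurClozelAMS120, Ch. 3, Thm. 4.2 (a) and its proof, pp. 203–205] -/
theorem stub_weakLiftingGL2_of_liftDatum_rank2
    (hI : ∀ {F E : Type} [Field F] [NumberField F] [Field E] [NumberField E] [Algebra F E] [IsGalois F E], Module.finrank F E = 2 → ∀ (μ : Measure (gl 2 F).automorphicQuotient) [(gl 2 F).IsAutomorphicMeasure μ] (P : CuspidalAutomorphicRepGL 2 F μ) (ν : (a : ℕ) → Measure (gl a E).automorphicQuotient) [∀ a, (gl a E).IsAutomorphicMeasure (ν a)], ∃ (M : Type) (_ : Fintype M) (d : M → ℕ) (Q : ∀ m, CuspidalAutomorphicRepGL (d m) E (ν (d m))) (s : M → ℂ) (S : Set (HeightOneSpectrum (𝓞 F))) (α : SatakeFamily F) (A : M → SatakeFamily E), (∀ m, 0 < d m) ∧ ∑ m, d m = 2 ∧ ∑ m, (d m : ℂ) * s m = 0 ∧ S.Finite ∧ IsSatakeFamilyOf P S α ∧ (∀ m, IsSatakeFamilyOf (Q m) {w | w.under (𝓞 F) ∈ S} (A m)) ∧ ∀ w : HeightOneSpectrum (𝓞 E), w.under (𝓞 F) ∉ S → (α (w.under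 (𝓞 F))).map (· ^ w.asIdeal.inertiaDeg (𝓞 F)) = ∑ m, (A m w).map (((w.residueCard : ℂ) ^ (-(s m))) * ·))
    (hm1 : ∀ (K : Type) [Field K] [NumberField K] (μ : Measure (gl 2 K).automorphicQuotient)
      [(gl 2 K).IsAutomorphicMeasure μ], multiplicity_one_gl 2 K μ)
    (h22a : ∀ (K : Type) [Field K] [NumberField K] (μ : Measure (gl 2 K).automorphicQuotient)
      [(gl 2 K).IsAutomorphicMeasure μ],
      @JacquetShalika1981_partialPairL_boundary_of_ne_one 2 2 K _ _ μ _ μ _)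
    (h22c : ∀ (K : Type) [Field K] [NumberField K] (μ : Measure (gl 2 K).automorphicQuotient)
      [(gl 2 K).IsAutomorphicMeasure μ],
      @JacquetShalika1981_partialPairL_at_one_of_ne_conj 2 K _ _ μ _) :
    ∀ (F E : Type) [Field F] [NumberField F] [Field E] [NumberField E] [Algebra F E]
      [FiniteDimensional F E], Module.finrank F E = 2 → ArthurClozel1989_weakLifting_cuspidal 2 F E := by
  intro F E _ _ _ _ _ _ h2
  refine arthurClozel1989_weakLifting_cuspidal_of_exists ?_ fun ν _ =>
    strong_multiplicity_one_gl_of_jacquetShalika_unconditional (fun ν _ => hm1 E ν)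
      (fun ν _ => h22c E ν) fun ν _ => JacquetShalika1981_partialPairL_pole_of_eq_conj_holds_two
  intro _ hn hℓ η hη μ _ hmF P hP
  classical
  -- adapted from Literature/NumberTheory/Automorphic/ArthurClozelWeakLiftingIsobaric.lean
  -- (exists_cuspidal_weakLift_of_isobaricLiftFamilies), `hI` instantiated at `n = 2` only
  -- automorphic measures on all the `GL_a(𝔸_E) ⧸ A_G GL_a(E)`
  choose νE hνE using fun a => AdelicGroupData.exists_isAutomorphicMeasure_gl_holds a E
  haveI : ∀ a, (gl a E).IsAutomorphicMeasure (νE a) := hνE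
  -- the datum
  obtain ⟨M, _, d, Q, s, S₀, α, A, hd, hdn, hds, hS₀, hα, hA, hrel⟩ := hI h2 μ P νE
  -- an index minimising `re sₘ`
  have hMne : (Finset.univ : Finset M).Nonempty := by
    by_contra h
    rw [Finset.not_nonempty_iff_eq_empty, Finset.univ_eq_empty_iff] at h
    have h0 : ∑ m, d m = 0 := Finset.sum_eq_zero fun m _ => (IsEmpty.false m).elim
    omega
  obtain ⟨m₀, -, hm₀⟩ := Finset.exists_min_image Finset.univ (fun m => (s m).re) hMne
  have hm₀' : ∀ m, (s m₀).re ≤ (s m).re := fun m => hm₀ m (Finset.mem_univ m)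
  -- a level of `η`; the exceptional places: a finite set `S ⊇ S₀`
  obtain ⟨𝔪, h𝔪, hη𝔪⟩ := HeckeCharacter.exists_level_of_isFiniteOrder 2 hη.isFiniteOrder
  have h𝔪fin : {v : HeightOneSpectrum (𝓞 F) | v.asIdeal ∣ 𝔪}.Finite := Ideal.finite_factors h𝔪
  have hunrfin : {v : HeightOneSpectrum (𝓞 F) | ¬ Algebra.IsUnramifiedIn (𝓞 E) v.asIdeal}.Finite :=
    finite_setOf_not_isUnramifiedIn F E
  set S : Set (HeightOneSpectrum (𝓞 F)) :=
    (S₀ ∪ {v | v.asIdeal ∣ 𝔪}) ∪ {v | ¬ Algebra.IsUnramifiedIn (𝓞 E) v.asIdeal} with hSdef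
  have hS : S.Finite := (hS₀.union h𝔪fin).union hunrfin
  have hmemS : ∀ v, v ∈ S ↔ (v ∈ S₀ ∨ v.asIdeal ∣ 𝔪) ∨
      ¬ Algebra.IsUnramifiedIn (𝓞 E) v.asIdeal := fun v => by
    simp only [hSdef, Set.mem_union, Set.mem_setOf_eq]
  have hS₀S : S₀ ⊆ S := fun v hv => (hmemS v).mpr (Or.inl (Or.inl hv))
  have h𝔪S : ∀ v ∉ S, ¬ v.asIdeal ∣ 𝔪 := fun v hv h => hv ((hmemS v).mpr (Or.inl (Or.inr h)))
  have hunrS : ∀ v ∉ S, Algebra.IsUnramifiedIn (𝓞 E) v.asIdeal := fun v hv =>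
    by_contra fun h => hv ((hmemS v).mpr (Or.inr h))
  have hSE₀ : {w : HeightOneSpectrum (𝓞 E) | w.under (𝓞 F) ∈ S₀} ⊆ {w | w.under (𝓞 F) ∈ S} :=
    fun w hw => hS₀S hw
  -- the member-rank inputs over `E`, dispatched on the dichotomy `(1,1)` / `(2,2)`
  have hdich := memberRank_dichotomy hd hdn
  have h22aE : ∀ m m' : M, @JacquetShalika1981_partialPairL_boundary_of_ne_one (d m) (d m') E _ _ (νE (d m)) _ (νE (d m')) _ := by
    have key : ∀ a b : ℕ, (a = 1 ∧ b = 1) ∨ (a = 2 ∧ b = 2) →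
        @JacquetShalika1981_partialPairL_boundary_of_ne_one a b E _ _ (νE a) _ (νE b) _ := by
      rintro a b (⟨rfl, rfl⟩ | ⟨rfl, rfl⟩)
      · exact JacquetShalika1981_partialPairL_boundary_of_ne_one_one
      · exact h22a E (νE 2)
    exact fun m m' => key _ _ (hdich m m')
  have h22bE : ∀ m m' : M, @JacquetShalika1981_partialPairL_at_one_of_rank_ne (d m) (d m') E _ _ (νE (d m)) _ (νE (d m')) _ := by
    intro m m' hne
    rcases hdich m m' with ⟨h1, h1'⟩ | ⟨h2', h2''⟩
    · exact absurd (h1.trans h1'.symm) hne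
    · exact absurd (h2'.trans h2''.symm) hne
  have hrank : ∀ m : M, d m = 1 ∨ d m = 2 := fun m =>
    (hdich m m).imp (fun h => h.1) fun h => h.1
  have h22cE : ∀ m : M, @JacquetShalika1981_partialPairL_at_one_of_ne_conj (d m) E _ _ (νE (d m)) _ := by
    have key : ∀ a : ℕ, a = 1 ∨ a = 2 →
        @JacquetShalika1981_partialPairL_at_one_of_ne_conj a E _ _ (νE a) _ := by
      rintro a (rfl | rfl)
      · exact JacquetShalika1981_partialPairL_at_one_of_ne_conj_one
      · exact h22c E (νE 2)
    exact fun m => key _ (hrank m)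
  have h23E : ∀ m : M, @JacquetShalika1981_partialPairL_pole_of_eq_conj (d m) E _ _ (νE (d m)) _ := fun m =>
    JacquetShalika1981_partialPairL_pole_of_eq_conj_holds_of_le_two
      ((hrank m).elim (fun h => by omega) fun h => by omega)
  have hm1E : ∀ m : M, multiplicity_one_gl (d m) E (νE (d m)) := by
    have key : ∀ a : ℕ, a = 1 ∨ a = 2 → multiplicity_one_gl a E (νE a) := by
      rintro a (rfl | rfl)
      · exact multiplicity_one_gl_one E (νE 1)
      · exact hm1 E (νE 2)
    exact fun m => key _ (hrank m)
  -- the `L`-function argument: one member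
  have hcard : Fintype.card M ≤ 1 :=
    stub_card_le_one_of_isobaricWeakLift_members 2 hℓ νE (h22a F μ) (h22c F μ)
      JacquetShalika1981_partialPairL_pole_of_eq_conj_holds_two hmF hn P hη hP h𝔪 hη𝔪 hS h𝔪S
      hunrS (hα.mono hS₀S) d hd Q h22aE h22bE h22cE h23E hm1E s m₀ hm₀' hds
      (fun m => (hA m).mono hSE₀) (fun w hw => hrel w fun h => hw (hS₀S h))
  have huniq : ∀ m, m = m₀ := fun m => Fintype.card_le_one_iff.mp hcard m m₀
  have hsum1 : ∀ {N : Type} [AddCommMonoid N] (f : M → N), ∑ m, f m = f m₀ := fun f =>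
    Finset.sum_eq_single m₀ (fun m _ hne => absurd (huniq m) hne)
      fun h => absurd (Finset.mem_univ m₀) h
  have hdm₀ : d m₀ = 2 := by
    rw [hsum1] at hdn
    exact hdn
  have hs0 : s m₀ = 0 := by
    rw [hsum1] at hds
    exact (mul_eq_zero.mp hds).resolve_left (Nat.cast_ne_zero.mpr (hd m₀).ne')
  refine exists_cuspidal_weakLift_of_rank_eq hdm₀ P (Q m₀) hS₀ hα (hA m₀) fun w hw => ?_
  rw [hrel w hw, hsum1, hs0, neg_zero, Complex.cpow_zero]
  simp only [one_mul, Multiset.map_id']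

end Summit.Langlands.Langlands.Theorems.QuadraticBaseChangeGL2

end
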